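import Summits.KontsevichZagierPeriods.KontsevichZagierPeriods.Theses.BoundaryLevel
import Summits.KontsevichZagierPeriods.KontsevichZagierPeriods.Theorems.InverseLandauTateLiftingAffineChart
import Summits.KontsevichZagierPeriods.KontsevichZagierPeriods.Theorems.HyperbolicBlochOffTetraSectorKernelRedAux

/-!
# `EllipsoidCalibration` (stmt-KontsevichZagierPeriods-11391, route BoundaryLevel) — proof

For a rational symmetric positive-definite `3 × 3` matrix `A`, the volume representation
`[{x | xᵀAx < 1}, 1]` of the open ellipsoid and the representation `[{y | Σ yᵢ² < 1}, (√det A)⁻¹]`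
on the open unit ball differ by ONE change of variables of the Kontsevich–Zagier calculus
(`KZ.changeOfVariablesRel`, rule (2)), namely the linear map `Φ x = L x` with `LᵀL = A`.

We take for `L` the Cholesky factor `L = D^{1/2} U` of Lagrange's completion of squares
`A = Uᵀ D U`: `U` is unit upper triangular with RATIONAL entries `u₁₂ = a₀₁/a₀₀`, `u₁₃ = a₀₂/a₀₀`,
`u₂₃ = (a₀₀a₁₂ − a₀₁a₀₂)/m₂` and `D = diag(a₀₀, m₂/a₀₀, det A/m₂)` with `m₂ = a₀₀a₁₁ − a₀₁²`; the
three leading principal minors `a₀₀, m₂, det A` are positive (evaluate the form at `(1,0,0)`,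
`(−a₀₁, a₀₀, 0)` and at the cofactor vector `adj(A) e₃`). Hence the entries of `L` are real
ALGEBRAIC numbers (rationals times square roots of positive rationals,
`HyperbolicBloch.OffTetraSectorKernel.redAux_isAlgebraic_sqrt`), so `Φ` is `ℚ`-semialgebraic
by the tree's affine engine (`InverseLandau.AffineEngine.isSemialgebraicMapOn_affine`); `Φ` is its
own derivative, `|L x|² = xᵀAx` so that `Φ` maps the ellipsoid onto the ball (`L` is invertible,
`det L = √a₀₀ · √(m₂/a₀₀) · √(det A/m₂) = √det A > 0`), and the Jacobian identity reads
`1 = (√det A)⁻¹ · |det L|`.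

References: M. Kontsevich, D. Zagier, *Periods* (2001), §1.2 rule (2); the calibration
`Vol = (4π/3)/√det A` is the level-0 (Tate) case of route BoundaryLevel.
-/

noncomputable section

open Set
open Literature.NumberTheory.Transcendental

namespace Summit.KontsevichZagierPeriods.BoundaryLevel

/-- **Leading principal minors of a positive-definite ternary form are positive.** If the real
symmetric form `a₀₀x₀² + 2a₀₁x₀x₁ + 2a₀₂x₀x₂ + a₁₁x₁² + 2a₁₂x₁x₂ + a₂₂x₂²` is positive at every
`x ≠ 0`, then `a₀₀ > 0`, `a₀₀a₁₁ − a₀₁² > 0` and `det > 0`: evaluate at `(1,0,0)`, at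
`(−a₀₁, a₀₀, 0)` (value `a₀₀ · (a₀₀a₁₁ − a₀₁²)`) and at the cofactor vector `adj(A) e₃`
(value `(a₀₀a₁₁ − a₀₁²) · det`). [folklore] -/
theorem minors_pos {a₀₀ a₀₁ a₀₂ a₁₁ a₁₂ a₂₂ : ℝ}
    (hpos : ∀ x : Fin 3 → ℝ, x ≠ 0 → 0 < a₀₀ * x 0 ^ 2 + 2 * a₀₁ * x 0 * x 1 +
      2 * a₀₂ * x 0 * x 2 + a₁₁ * x 1 ^ 2 + 2 * a₁₂ * x 1 * x 2 + a₂₂ * x 2 ^ 2) :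
    0 < a₀₀ ∧ 0 < a₀₀ * a₁₁ - a₀₁ ^ 2 ∧
      0 < a₀₀ * a₁₁ * a₂₂ - a₀₀ * a₁₂ * a₁₂ - a₀₁ * a₀₁ * a₂₂ + a₀₁ * a₁₂ * a₀₂ +
        a₀₂ * a₀₁ * a₁₂ - a₀₂ * a₁₁ * a₀₂ := by
  have h1 : 0 < a₀₀ := by
    have hv : (![1, 0, 0] : Fin 3 → ℝ) ≠ 0 := fun h => by simpa using congr_fun h 0
    have h := hpos _ hv
    simp only [Matrix.cons_val] at h
    convert h using 1
    ring
  have h2 : 0 < a₀₀ * a₁₁ - a₀₁ ^ 2 := by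
    have hv : (![-a₀₁, a₀₀, 0] : Fin 3 → ℝ) ≠ 0 := fun h => h1.ne' (by simpa using congr_fun h 1)
    have h := hpos _ hv
    simp only [Matrix.cons_val] at h
    have h' : (0 : ℝ) < a₀₀ * (a₀₀ * a₁₁ - a₀₁ ^ 2) := by
      convert h using 1
      ring
    exact (mul_pos_iff_of_pos_left h1).mp h'
  refine ⟨h1, h2, ?_⟩
  have hv : (![a₀₁ * a₁₂ - a₀₂ * a₁₁, a₀₁ * a₀₂ - a₀₀ * a₁₂, a₀₀ * a₁₁ - a₀₁ ^ 2] : Fin 3 → ℝ) ≠ 0 :=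
    fun h => h2.ne' (by simpa using congr_fun h 2)
  have h := hpos _ hv
  simp only [Matrix.cons_val] at h
  have h' : (0 : ℝ) < (a₀₀ * a₁₁ - a₀₁ ^ 2) * (a₀₀ * a₁₁ * a₂₂ - a₀₀ * a₁₂ * a₁₂ -
      a₀₁ * a₀₁ * a₂₂ + a₀₁ * a₁₂ * a₀₂ + a₀₂ * a₀₁ * a₁₂ - a₀₂ * a₁₁ * a₀₂) := by
    convert h using 1
    ring
  exact (mul_pos_iff_of_pos_left h2).mp h'

/-- **Real-algebraic Cholesky factor of a positive-definite rational ternary form** (Lagrange's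
completion of squares `A = Uᵀ D U`, `L = D^{1/2} U`): if `a₀₀ > 0`, `m₂ = a₀₀a₁₁ − a₀₁² > 0` and
`D = det A > 0`, the upper-triangular real matrix
`L = !![√a₀₀, √a₀₀·a₀₁/a₀₀, √a₀₀·a₀₂/a₀₀; 0, √(m₂/a₀₀), √(m₂/a₀₀)·(a₀₀a₁₂ − a₀₁a₀₂)/m₂; 0, 0, √(D/m₂)]`
has real-algebraic entries, determinant `√D`, and `|L x|² = xᵀAx`. [folklore] -/
theorem exists_cholesky {a₀₀ a₀₁ a₀₂ a₁₁ a₁₂ a₂₂ D : ℚ}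
    (hD : D = a₀₀ * a₁₁ * a₂₂ - a₀₀ * a₁₂ * a₁₂ - a₀₁ * a₀₁ * a₂₂ + a₀₁ * a₁₂ * a₀₂ +
      a₀₂ * a₀₁ * a₁₂ - a₀₂ * a₁₁ * a₀₂)
    (h1 : 0 < a₀₀) (h2 : 0 < a₀₀ * a₁₁ - a₀₁ ^ 2) (h3 : 0 < D) :
    ∃ L : Matrix (Fin 3) (Fin 3) ℝ, (∀ i j, IsAlgebraic ℚ (L i j)) ∧
      L.det = Real.sqrt (D : ℝ) ∧
      ∀ x : Fin 3 → ℝ, ∑ i, (L.mulVec x) i ^ 2 =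
        (a₀₀ : ℝ) * x 0 ^ 2 + 2 * (a₀₁ : ℝ) * x 0 * x 1 + 2 * (a₀₂ : ℝ) * x 0 * x 2 +
          (a₁₁ : ℝ) * x 1 ^ 2 + 2 * (a₁₂ : ℝ) * x 1 * x 2 + (a₂₂ : ℝ) * x 2 ^ 2 := by
  -- Lagrange's data over `ℚ`: `D = diag(a₀₀, d₂, d₃)`, `U = !![1, u₁₂, u₁₃; 0, 1, u₂₃; 0, 0, 1]`
  obtain ⟨d₂, hd₂⟩ : ∃ q : ℚ, q = (a₀₀ * a₁₁ - a₀₁ ^ 2) / a₀₀ := ⟨_, rfl⟩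
  obtain ⟨d₃, hd₃⟩ : ∃ q : ℚ, q = D / (a₀₀ * a₁₁ - a₀₁ ^ 2) := ⟨_, rfl⟩
  obtain ⟨u₁₂, hu₁₂⟩ : ∃ q : ℚ, q = a₀₁ / a₀₀ := ⟨_, rfl⟩
  obtain ⟨u₁₃, hu₁₃⟩ : ∃ q : ℚ, q = a₀₂ / a₀₀ := ⟨_, rfl⟩
  obtain ⟨u₂₃, hu₂₃⟩ : ∃ q : ℚ, q = (a₀₀ * a₁₂ - a₀₁ * a₀₂) / (a₀₀ * a₁₁ - a₀₁ ^ 2) := ⟨_, rfl⟩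
  have hd2 : 0 < d₂ := hd₂ ▸ div_pos h2 h1
  have hd3 : 0 < d₃ := hd₃ ▸ div_pos h3 h2
  have ha0 : (a₀₀ : ℝ) ≠ 0 := by exact_mod_cast h1.ne'
  have hm0 : ((a₀₀ * a₁₁ - a₀₁ ^ 2 : ℚ) : ℝ) ≠ 0 := by exact_mod_cast h2.ne'
  push_cast at hm0
  -- the three square roots
  have n1 : (0 : ℝ) ≤ a₀₀ := by exact_mod_cast h1.le
  have n2 : (0 : ℝ) ≤ d₂ := by exact_mod_cast hd2.le
  have n3 : (0 : ℝ) ≤ d₃ := by exact_mod_cast hd3.le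
  have e1 : Real.sqrt a₀₀ ^ 2 = (a₀₀ : ℝ) := Real.sq_sqrt n1
  have e2 : Real.sqrt d₂ ^ 2 = (d₂ : ℝ) := Real.sq_sqrt n2
  have e3 : Real.sqrt d₃ ^ 2 = (d₃ : ℝ) := Real.sq_sqrt n3
  -- (square roots of non-negative real algebraic numbers are algebraic: tree lemma
  -- `HyperbolicBloch.OffTetraSectorKernel.redAux_isAlgebraic_sqrt`)
  have s1 : IsAlgebraic ℚ (Real.sqrt a₀₀) :=
    HyperbolicBloch.OffTetraSectorKernel.redAux_isAlgebraic_sqrt (isAlgebraic_rat ℚ _) n1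
  have s2 : IsAlgebraic ℚ (Real.sqrt d₂) :=
    HyperbolicBloch.OffTetraSectorKernel.redAux_isAlgebraic_sqrt (isAlgebraic_rat ℚ _) n2
  have s3 : IsAlgebraic ℚ (Real.sqrt d₃) :=
    HyperbolicBloch.OffTetraSectorKernel.redAux_isAlgebraic_sqrt (isAlgebraic_rat ℚ _) n3
  refine ⟨!![Real.sqrt a₀₀, Real.sqrt a₀₀ * u₁₂, Real.sqrt a₀₀ * u₁₃;
      0, Real.sqrt d₂, Real.sqrt d₂ * u₂₃; 0, 0, Real.sqrt d₃], ?_, ?_, ?_⟩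
  · -- the entries `√d · u` are real algebraic
    intro i j
    fin_cases i <;> fin_cases j
    exacts [s1, s1.mul (isAlgebraic_rat ℚ _), s1.mul (isAlgebraic_rat ℚ _), isAlgebraic_zero, s2,
      s2.mul (isAlgebraic_rat ℚ _), isAlgebraic_zero, isAlgebraic_zero, s3]
  · -- `det L = √a₀₀ · √d₂ · √d₃ = √(a₀₀ d₂ d₃) = √D`
    have hprod : (D : ℝ) = a₀₀ * (d₂ * d₃) := by
      rw [hd₂, hd₃]
      push_cast
      field_simp
    rw [Matrix.det_fin_three, hprod, Real.sqrt_mul n1, Real.sqrt_mul n2]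
    simp only [Matrix.of_apply, Matrix.cons_val', Matrix.cons_val]
    ring
  · -- `|L x|² = a₀₀ (x₀ + u₁₂x₁ + u₁₃x₂)² + d₂ (x₁ + u₂₃x₂)² + d₃ x₂² = xᵀAx`
    intro x
    have key : (a₀₀ : ℝ) * (x 0 + u₁₂ * x 1 + u₁₃ * x 2) ^ 2 + d₂ * (x 1 + u₂₃ * x 2) ^ 2 +
        d₃ * x 2 ^ 2 =
        (a₀₀ : ℝ) * x 0 ^ 2 + 2 * (a₀₁ : ℝ) * x 0 * x 1 + 2 * (a₀₂ : ℝ) * x 0 * x 2 +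
          (a₁₁ : ℝ) * x 1 ^ 2 + 2 * (a₁₂ : ℝ) * x 1 * x 2 + (a₂₂ : ℝ) * x 2 ^ 2 := by
      rw [hd₂, hd₃, hu₁₂, hu₁₃, hu₂₃, hD]
      push_cast
      field_simp
      ring
    simp only [Matrix.mulVec, dotProduct, Fin.sum_univ_three, Matrix.of_apply, Matrix.cons_val',
      Matrix.cons_val]
    linear_combination key + (x 0 + u₁₂ * x 1 + u₁₃ * x 2) ^ 2 * e1 +
      (x 1 + u₂₃ * x 2) ^ 2 * e2 + x 2 ^ 2 * e3

/-- **`EllipsoidCalibration`** (route BoundaryLevel, stmt-KontsevichZagierPeriods-11391): for a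
rational symmetric positive-definite `3 × 3` matrix `A` and representations `r = [{xᵀAx < 1}, 1]`,
`r' = [{Σ yᵢ² < 1}, (√det A)⁻¹]`, the difference `[r] − [r']` is ONE change-of-variables move
`KZ.changeOfVariablesRel`: along `Φ x = L x` with `L` the real-algebraic Cholesky factor
(`LᵀL = A`, `exists_cholesky`), which is `ℚ`-semialgebraic (affine engine), is its own derivative,
is injective with `det L = √det A > 0`, maps the ellipsoid onto the unit ball (`|L x|² = xᵀAx`),
and satisfies the Jacobian identity `1 = (√det A)⁻¹ · |det L|`.
[cite: KontsevichZagier2001, §1.2 rule (2)] -/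
theorem ellipsoidCalibration_proof :
    Summit.KontsevichZagierPeriods.KontsevichZagierPeriods.Theses.BoundaryLevel.EllipsoidCalibration := by
  intro A hA hpos r r' hr hint hr' hint'
  -- the quadratic form and the determinant in closed form (symmetry of `A`)
  have h10 : ((A 1 0 : ℚ) : ℝ) = A 0 1 := by rw [hA.apply 0 1]
  have h20 : ((A 2 0 : ℚ) : ℝ) = A 0 2 := by rw [hA.apply 0 2]
  have h21 : ((A 2 1 : ℚ) : ℝ) = A 1 2 := by rw [hA.apply 1 2]
  have hQ : ∀ x : Fin 3 → ℝ, ∑ i, ∑ j, (A i j : ℝ) * x i * x j =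
      (A 0 0 : ℝ) * x 0 ^ 2 + 2 * (A 0 1 : ℝ) * x 0 * x 1 + 2 * (A 0 2 : ℝ) * x 0 * x 2 +
        (A 1 1 : ℝ) * x 1 ^ 2 + 2 * (A 1 2 : ℝ) * x 1 * x 2 + (A 2 2 : ℝ) * x 2 ^ 2 := fun x => by
    simp only [Fin.sum_univ_three, h10, h20, h21]
    ring
  have hdet : A.det = A 0 0 * A 1 1 * A 2 2 - A 0 0 * A 1 2 * A 1 2 - A 0 1 * A 0 1 * A 2 2 +
      A 0 1 * A 1 2 * A 0 2 + A 0 2 * A 0 1 * A 1 2 - A 0 2 * A 1 1 * A 0 2 := by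
    rw [Matrix.det_fin_three, hA.apply 0 1, hA.apply 0 2, hA.apply 1 2]
  -- the leading principal minors are positive
  obtain ⟨h1, h2, h3⟩ := minors_pos fun x hx => (hpos x hx).trans_eq (hQ x)
  have q1 : 0 < A 0 0 := by exact_mod_cast h1
  have q2 : 0 < A 0 0 * A 1 1 - A 0 1 ^ 2 := by exact_mod_cast h2
  have q3 : 0 < A.det := by rw [hdet]; exact_mod_cast h3
  have hdetpos : 0 < ((A.det : ℚ) : ℝ) := by exact_mod_cast q3
  have hsqrt : 0 < Real.sqrt (A.det : ℝ) := Real.sqrt_pos.mpr hdetpos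
  -- the Cholesky factor `L`: algebraic entries, `det L = √det A`, `|L x|² = xᵀAx`
  obtain ⟨L, hLalg, hLdet, hLQ⟩ := exists_cholesky hdet q1 q2 q3
  have hnorm : ∀ x, ∑ i, (L.mulVec x) i ^ 2 = ∑ i, ∑ j, (A i j : ℝ) * x i * x j := fun x => by
    rw [hLQ, hQ]
  have hdetL : L.det ≠ 0 := by rw [hLdet]; exact hsqrt.ne'
  have hU : IsUnit L := (Matrix.isUnit_iff_isUnit_det L).mpr (isUnit_iff_ne_zero.mpr hdetL)
  -- `Φ = L.mulVec` is its own derivative `T`, of determinant `det L`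
  set T : (Fin 3 → ℝ) →L[ℝ] (Fin 3 → ℝ) := LinearMap.toContinuousLinearMap (Matrix.toLin' L)
    with hT
  have hTcoe : (T : (Fin 3 → ℝ) → (Fin 3 → ℝ)) = L.mulVec := funext fun x => by
    rw [hT, LinearMap.coe_toContinuousLinearMap', Matrix.toLin'_apply]
  have hTdet : T.det = L.det := by
    rw [hT, LinearMap.det_toContinuousLinearMap, LinearMap.det_toLin']
  -- `Φ` maps the ellipsoid onto the unit ball
  have himage : r'.domain = L.mulVec '' r.domain := by
    rw [hr, hr']
    ext y
    constructor
    · intro hy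
      obtain ⟨x, rfl⟩ := Matrix.mulVec_surjective_iff_isUnit.mpr hU y
      refine ⟨x, ?_, rfl⟩
      rw [mem_setOf_eq, ← hnorm]
      exact hy
    · rintro ⟨x, hx, rfl⟩
      rw [mem_setOf_eq, hnorm]
      exact hx
  refine ⟨3, r, r', L.mulVec, fun _ => T, ?_, fun x _ => ?_,
    (Matrix.mulVec_injective_iff_isUnit.mpr hU).injOn, himage, fun x hx => ?_, rfl⟩
  · -- `Φ` is `ℚ`-semialgebraic on `r.domain`: real-algebraic linear map (affine engine, `b = 0`)
    exact (InverseLandau.AffineEngine.isSemialgebraicMapOn_affine hLalg (fun _ => isAlgebraic_zero)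
      r.isSemialgebraic_domain).congr fun x _ => add_zero _
  · -- derivative
    have h : HasFDerivAt (T : (Fin 3 → ℝ) → (Fin 3 → ℝ)) T x := T.hasFDerivAt
    rw [hTcoe] at h
    exact h.hasFDerivWithinAt
  · -- Jacobian identity `1 = (√det A)⁻¹ · |det L|`
    show r.integrand x = r'.integrand (L.mulVec x) * |T.det|
    have hΦx : L.mulVec x ∈ r'.domain := himage ▸ mem_image_of_mem _ hx
    rw [hint x hx, hint' _ hΦx, hTdet, hLdet, abs_of_pos hsqrt, inv_mul_cancel₀ hsqrt.ne']

end Summit.KontsevichZagierPeriods.BoundaryLevel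

end
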